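import Summits.BirchSwinnertonDyer.BirchSwinnertonDyer.Theorems.EisensteinPrimesGoodLatticeAnacongOfCGLSProofOfDatum
import HarnessLib

/-!
# `thm222_anacong_goodLattice_of_ne_one` (the «φ̃|_{Γ_K} ≠ 𝟙» sibling of content stub 3a-A) BY NAME from CGLS's proof of Thm. 2.2.1
# and Hida's Thm. I — no full-descent datum needed when the quotient character is non-trivial (Kriz Def. 31 (5) is vacuous)
# (cell `bsd-eis`, width seat `bsd-line-x1-p1-w2` gen 26; `--supports stmt-BirchSwinnertonDyer-19032`)

WHY. `GoodLatticeAnacongOfCGLSProofOfDatum.thm222_anacong_goodLattice_of_fullDescentDatum_of_proofThm221_of_thmI` (p761499) derives 3a-A from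
the two named facts using the DATUM only for Kriz's condition (5) in the case `φ̃ = 𝟙`. The named fact
`KellerYin2024.thm222_anacong_goodLattice_of_ne_one` (CGLS Thm. 2.2.2's anomalous case with `φ|_{G_K} ≠ 𝟙`) carries instead the
hypothesis `¬ ∀ σ : Γ_K, θquot σ = 1`; then `φ̃ ≠ 𝟙` on `Γ_ℚ` too and (5) never triggers. This file records that: the type
construction with the datum demanded ONLY IF `φ̃ = 𝟙` (`exists_fullDescentType_of_datum_of_eq_one`, the proof of
`GoodLatticeKrizDescentTypeOfDatum.exists_fullDescentType_of_datum` verbatim with the weaker hypothesis), and the by-name corollary.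

* `exists_fullDescentType_of_datum_of_eq_one` — type `(N₊, N₋, N₀)` with Kriz (2)–(5), datum required only when `θquot = 𝟙`.
* `thm222_anacong_goodLattice_of_ne_one_of_proofThm221_of_thmI` — `proofThm221_… → thmI_… → KellerYin2024.thm222_anacong_goodLattice_of_ne_one`.

HONEST FRAMING: theorems only (0 definitions, 0 named facts, 0 sorry); CONDITIONAL on the two named facts; `_of_ne_one` is idle in the
line of record (v33N) — this is bookkeeping that removes one more composed atom by name; no summit statement / crux / stub / BSD proved.
References: [Kriz2016] Def. 31 (5), Rem. 32 («automatic iff ψ₁ ≠ 1»); [CastellaGrossiLeeSkinner2022] Thm. 2.2.1/2.2.2; [Hida2010MuInvariant] Thm. I.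
-/

set_option autoImplicit false
set_option linter.dupNamespace false

noncomputable section

open scoped Classical

open WeierstrassCurve NumberField IsDedekindDomain Field PowerSeries
  Literature.NumberTheory.EllipticCurves Literature.NumberTheory.EllipticCurves.Rank1Residual
  Literature.NumberTheory.EllipticCurves.ModularForms
  Literature.NumberTheory.GaloisRepresentations Literature.NumberTheory.QuadraticFields
  Literature.NumberTheory.EllipticCurves.GreenbergSelmer
  Literature.NumberTheory.EllipticCurves.CastellaGrossiLeeSkinner2022
  Literature.NumberTheory.EllipticCurves.KellerYin2024
  Literature.NumberTheory.EllipticCurves.Hida2010MuInvariant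
  Summit.BirchSwinnertonDyer.Rank1Residual.X11b.Halves
  Summit.BirchSwinnertonDyer.BirchSwinnertonDyer.Theorems.GoodLatticeKrizPlacementDichotomyRat
  Summit.BirchSwinnertonDyer.BirchSwinnertonDyer.Theorems.GoodLatticeKrizDescentTypeOfDatum

namespace Summit.BirchSwinnertonDyer.BirchSwinnertonDyer.Theorems.GoodLatticeAnacongOfCGLSProofOfNeOne

variable {p : ℕ} [hp : Fact p.Prime] {S : Set (PadicAlgCl p)}

/-- **The full-descent type with the datum demanded only when `φ̃ = 𝟙`** — the statement and proof of
`GoodLatticeKrizDescentTypeOfDatum.exists_fullDescentType_of_datum` with the hypothesis weakened to `(θquot = 𝟙) → datum`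
(the datum is used only for Kriz Def. 31 (5)). [cite: Kriz2016, Def. 31 (2)–(5), Rem. 32, Rem. 33, Thm. 34 (2)(3), Thm. 35] -/
theorem exists_fullDescentType_of_datum_of_eq_one (W : WeierstrassCurve ℚ) [W.IsElliptic] [W.IsGloballyMinimal] (hgood : Good W p)
    {Φ : AddSubgroup (geomTorsion W (p : ℤ))} (hΦ : IsRationalLine W p Φ)
    {θsub θquot : FramedGaloisRep ℚ (padicCoeffIntegers S) 1}
    (hsub : IsTeichmullerLiftOn S (Φ.map (geomTorsion W (p : ℤ)).subtype) θsub)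
    (hquot : IsTeichmullerLiftOnQuot S (Φ.map (geomTorsion W (p : ℤ)).subtype) (geomTorsion W (p : ℤ)) θquot)
    (hdatum : (∀ σ : absoluteGaloisGroup ℚ, θquot σ = 1) →
      ((∃ (ℓ : ℕ) (hℓ : ℓ.Prime), haveI : Fact ℓ.Prime := ⟨hℓ⟩; Addv W ℓ) ∨
      (∃ (ℓ : ℕ) (hℓ : ℓ.Prime), haveI : Fact ℓ.Prime := ⟨hℓ⟩;
        W.HasMultiplicativeReductionAtPrime ℓ ∧
          ((W.HasSplitMultiplicativeReductionAtPrime ℓ ∧ ℓ ≡ 1 [MOD p]) ∨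
            (¬ W.HasSplitMultiplicativeReductionAtPrime ℓ ∧ ℓ + 1 ≡ 0 [MOD p]))))) :
    ∃ Nplus Nminus Nzero : Finset ℕ,
      Nplus ⊆ (W.conductorNorm ℤ).primeFactors ∧ Nminus ⊆ (W.conductorNorm ℤ).primeFactors ∧
      Nzero ⊆ (W.conductorNorm ℤ).primeFactors ∧
      (∀ (ℓ : ℕ) (hℓ : ℓ ∈ (W.conductorNorm ℤ).primeFactors),
        haveI : Fact ℓ.Prime := ⟨Nat.prime_of_mem_primeFactors hℓ⟩
        (ℓ ∈ Nzero ↔ ¬ W.HasMultiplicativeReductionAtPrime ℓ) ∧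
        ((ℓ ∈ Nplus ∨ ℓ ∈ Nminus) ↔ W.HasMultiplicativeReductionAtPrime ℓ) ∧ ¬ (ℓ ∈ Nplus ∧ ℓ ∈ Nminus)) ∧
      (∀ ℓ ∈ Nplus, ∀ u : HeightOneSpectrum (𝓞 ℚ), ((ℓ : ℕ) : 𝓞 ℚ) ∈ u.asIdeal → θquot.IsUnramifiedAt u ∧
        ∀ a : padicCoeffIntegers S, θquot.HasFrobCharpolyAt u (Polynomial.X - Polynomial.C a) →
        ‖((W.LFunction ℓ : ℤ) : PadicAlgCl p) - (a : PadicAlgCl p)‖ < 1) ∧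
      (∀ ℓ ∈ Nminus, ∀ u : HeightOneSpectrum (𝓞 ℚ), ((ℓ : ℕ) : 𝓞 ℚ) ∈ u.asIdeal → θquot.IsUnramifiedAt u ∧
        ∀ a : padicCoeffIntegers S, θquot.HasFrobCharpolyAt u (Polynomial.X - Polynomial.C a) →
        ‖((W.LFunction ℓ : ℤ) : PadicAlgCl p) - (a : PadicAlgCl p)⁻¹ * (ℓ : PadicAlgCl p)‖ < 1) ∧
      (∀ ℓ ∈ Nzero, ‖((W.LFunction ℓ : ℤ) : PadicAlgCl p)‖ < 1) ∧
      ((∀ σ : absoluteGaloisGroup ℚ, θquot σ = 1) →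
        ‖(((1 : ℚ) / 24 * ((∏ ℓ ∈ Nplus, (1 - (ℓ : ℚ))) * (∏ _ℓ ∈ Nminus, ((1 : ℚ) - 1)) *
            (∏ ℓ ∈ Nzero, (1 - (ℓ : ℚ)) * ((1 : ℚ) - 1))) : ℚ) : ℚ_[p])‖ < 1) := by
  have hpp := hp.out
  set PF := (W.conductorNorm ℤ).primeFactors with hPF
  have hpN : ¬ p ∣ W.conductorNorm ℤ := not_dvd_conductorNorm_of_hasGoodReductionAtPrime W hgood
  -- the predicates (independent of the primality proof)
  let mult : ℕ → Prop := fun ℓ ↦ ∃ h : ℓ.Prime, (haveI : Fact ℓ.Prime := ⟨h⟩; W.HasMultiplicativeReductionAtPrime ℓ)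
  let minus : ℕ → Prop := fun ℓ ↦ mult ℓ ∧ ∀ u : HeightOneSpectrum (𝓞 ℚ), ((ℓ : ℕ) : 𝓞 ℚ) ∈ u.asIdeal →
    θquot.IsUnramifiedAt u ∧ ∀ a : padicCoeffIntegers S, θquot.HasFrobCharpolyAt u (Polynomial.X - Polynomial.C a) →
      ‖((W.LFunction ℓ : ℤ) : PadicAlgCl p) - (a : PadicAlgCl p)⁻¹ * (ℓ : PadicAlgCl p)‖ < 1
  refine ⟨PF.filter (fun ℓ ↦ mult ℓ ∧ ¬ minus ℓ), PF.filter minus, PF.filter (fun ℓ ↦ ¬ mult ℓ),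
    Finset.filter_subset _ _, Finset.filter_subset _ _, Finset.filter_subset _ _, ?_, ?_, ?_, ?_, ?_⟩
  · -- the type
    intro ℓ hℓ
    have hℓp' : ℓ.Prime := Nat.prime_of_mem_primeFactors hℓ
    have hmult_iff : mult ℓ ↔ (haveI : Fact ℓ.Prime := ⟨hℓp'⟩; W.HasMultiplicativeReductionAtPrime ℓ) :=
      ⟨fun ⟨_, h⟩ ↦ h, fun h ↦ ⟨hℓp', h⟩⟩
    have hℓPF : ℓ ∈ PF := hℓ
    refine ⟨?_, ?_, ?_⟩
    · rw [Finset.mem_filter, ← hmult_iff]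
      exact ⟨fun h ↦ h.2, fun h ↦ ⟨hℓPF, h⟩⟩
    · rw [Finset.mem_filter, Finset.mem_filter, ← hmult_iff]
      constructor
      · rintro (⟨-, hm, -⟩ | ⟨-, hmin⟩)
        · exact hm
        · exact hmin.1
      · intro hm
        by_cases hmin : minus ℓ
        · exact Or.inr ⟨hℓPF, hmin⟩
        · exact Or.inl ⟨hℓPF, hm, hmin⟩
    · rintro ⟨h1, h2⟩
      rw [Finset.mem_filter] at h1 h2
      exact h1.2.2 h2.2
  · -- (2) on `N₊`
    intro ℓ hℓ u hu
    rw [Finset.mem_filter] at hℓ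
    obtain ⟨hℓPF, ⟨hℓprime, hm⟩, hnot⟩ := hℓ
    haveI : Fact ℓ.Prime := ⟨hℓprime⟩
    have hℓp : ℓ ≠ p := fun h' ↦ hpN (h' ▸ Nat.dvd_of_mem_primeFactors hℓPF)
    obtain ⟨hunr, hdich⟩ := placement_dichotomy_rat W hΦ hsub hquot hℓp hm hu
    refine ⟨hunr, ?_⟩
    rcases hdich with h | h
    · exact h
    · exfalso
      apply hnot
      refine ⟨⟨hℓprime, hm⟩, fun u' hu' ↦ ?_⟩
      have huu : u' = u := by
        rw [(natCast_mem_asIdeal_iff_eq_primesEquiv_symm u' hℓprime).mp hu',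
          (natCast_mem_asIdeal_iff_eq_primesEquiv_symm u hℓprime).mp hu]
      subst huu
      exact ⟨hunr, h⟩
  · -- (3) on `N₋`
    intro ℓ hℓ u hu
    rw [Finset.mem_filter] at hℓ
    exact hℓ.2.2 u hu
  · -- (4) on `N₀`: `a_ℓ = 0` at an additive prime
    intro ℓ hℓ
    rw [Finset.mem_filter] at hℓ
    obtain ⟨hℓPF, hnm⟩ := hℓ
    have hℓprime : ℓ.Prime := Nat.prime_of_mem_primeFactors hℓPF
    haveI : Fact ℓ.Prime := ⟨hℓprime⟩
    set v : HeightOneSpectrum (𝓞 ℚ) := (Rat.HeightOneSpectrum.primesEquiv (R := 𝓞 ℚ)).symm ⟨ℓ, hℓprime⟩ with hv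
    have hvℓ : (Rat.HeightOneSpectrum.primesEquiv v : ℕ) = ℓ := by rw [hv, Equiv.apply_symm_apply]
    have hbad : ¬ W.HasGoodReductionAt v := (W.dvd_conductorNorm_iff v).mp (hvℓ ▸ Nat.dvd_of_mem_primeFactors hℓPF)
    have hnmv : ¬ W.HasMultiplicativeReductionAt v := fun h' ↦
      hnm ⟨hℓprime, by
        have key : ∀ (q : ℕ) (hq' : Fact q.Prime), q = ℓ →
            (haveI := hq'; W.HasMultiplicativeReductionAtPrime q) → W.HasMultiplicativeReductionAtPrime ℓ := by
          rintro q hq' rfl h''; exact h''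
        exact key _ _ hvℓ ((W.hasMultiplicativeReductionAtPrime_iff_hasMultiplicativeReductionAt_ringOfIntegers v).mpr h')⟩
    have hadd : W.HasAdditiveReductionAt v :=
      (Summit.BirchSwinnertonDyer.Rank1Residual.X2.NonPrimitiveLambdaShiftRat.additive_or_multiplicative_of_not_hasGoodReductionAt
        W hbad).resolve_right hnmv
    rw [← hvℓ, W.LFunction_apply_primesEquiv_of_hasAdditiveReductionAt hadd, Int.cast_zero, norm_zero]
    exact one_pos
  · -- (5): for `φ̃ = 𝟙` the datum puts a prime into `N₋ ∪ N₀`, whose factor `(1 − 1)` kills the product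
    intro hθ1
    have hzero : ((1 : ℚ) / 24 * ((∏ ℓ ∈ PF.filter (fun ℓ ↦ mult ℓ ∧ ¬ minus ℓ), (1 - (ℓ : ℚ))) *
        (∏ _ℓ ∈ PF.filter minus, ((1 : ℚ) - 1)) * (∏ ℓ ∈ PF.filter (fun ℓ ↦ ¬ mult ℓ), (1 - (ℓ : ℚ)) * ((1 : ℚ) - 1)))) = 0 := by
      rcases hdatum hθ1 with ⟨ℓ, hℓprime, haddv⟩ | ⟨ℓ, hℓprime, hm, hcong⟩
      · -- an additive prime lies in `N₀`
        haveI : Fact ℓ.Prime := ⟨hℓprime⟩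
        have hℓPF : ℓ ∈ PF := mem_primeFactors_of_not_hasGoodReductionAtPrime W haddv.1
        have hmem : ℓ ∈ PF.filter (fun ℓ ↦ ¬ mult ℓ) :=
          Finset.mem_filter.mpr ⟨hℓPF, fun ⟨_, h⟩ ↦ haddv.2 h⟩
        rw [Finset.prod_eq_zero hmem (by rw [sub_self, mul_zero])]
        ring
      · -- the datum's multiplicative prime `ℓ` (`a_ℓ ≡ ℓ`) lies in `N₋`
        haveI : Fact ℓ.Prime := ⟨hℓprime⟩
        have hℓPF : ℓ ∈ PF := mem_primeFactors_of_not_hasGoodReductionAtPrime W (fun hg ↦ by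
          set v : HeightOneSpectrum (𝓞 ℚ) := (Rat.HeightOneSpectrum.primesEquiv (R := 𝓞 ℚ)).symm ⟨ℓ, hℓprime⟩ with hv
          have hvℓ : (Rat.HeightOneSpectrum.primesEquiv v : ℕ) = ℓ := by rw [hv, Equiv.apply_symm_apply]
          have hℓv : ((ℓ : ℕ) : 𝓞 ℚ) ∈ v.asIdeal :=
            (natCast_mem_asIdeal_iff_eq_primesEquiv_symm v hℓprime).mpr rfl
          have hmultv := Summit.BirchSwinnertonDyer.Rank1Residual.X2.GreenbergVatsalStrictSelmerMultiplicative.hasMultiplicativeReductionAt_of_mem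
            W ℓ hm hℓv
          exact hmultv.not_hasGoodReductionAt ((hasGoodReductionAtPrime_primesEquiv_iff_holds W v ℓ hvℓ).mp hg))
        have hℓp : ℓ ≠ p := fun h' ↦ hpN (h' ▸ Nat.dvd_of_mem_primeFactors hℓPF)
        have hℓ0 : (ℓ : ZMod p) ≠ 0 := by
          rw [Ne, ZMod.natCast_eq_zero_iff]
          exact fun h' ↦ hℓp ((Nat.prime_dvd_prime_iff_eq hpp hℓprime).mp h').symm
        have hminus : minus ℓ := by
          refine ⟨⟨hℓprime, hm⟩, fun u hu ↦ ?_⟩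
          obtain ⟨hunr, -⟩ := placement_dichotomy_rat W hΦ hsub hquot hℓp hm hu
          refine ⟨hunr, fun a ha ↦ ?_⟩
          -- `θquot = 𝟙`: the Frobenius value is `1`
          obtain ⟨𝔓, h𝔓⟩ := HeightOneSpectrum.primesAbove_nonempty u
          obtain ⟨σ₁, hσ₁⟩ := HeightOneSpectrum.exists_isArithFrobAt_of_mem_primesAbove_holds h𝔓
          have ha1 : a = 1 := by
            have h := ha 𝔓 h𝔓 σ₁ hσ₁
            rw [GoodLatticeAnacongEulerCompMultiplicative.charpoly_eq_X_sub_C_entry, sub_right_inj, Polynomial.C_inj] at h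
            rw [← h]
            unfold KellerYin2024.entry
            rw [hθ1 σ₁, Units.val_one, Matrix.one_apply_eq]
          subst ha1
          have hvℓ : (Rat.HeightOneSpectrum.primesEquiv u : ℕ) = ℓ := Rat.HeightOneSpectrum.primesEquiv_eq_of_natCast_mem _ hℓprime hu
          have hmultv := Summit.BirchSwinnertonDyer.Rank1Residual.X2.GreenbergVatsalStrictSelmerMultiplicative.hasMultiplicativeReductionAt_of_mem
            W ℓ hm hu
          push_cast
          rw [inv_one, one_mul]
          -- `a_ℓ = ε ≡ ℓ` by the datum's congruence
          rcases hcong with ⟨hsp, hℓ1⟩ | ⟨hns, hℓ1⟩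
          · have hsplitv : W.HasSplitMultiplicativeReductionAt u := by
              refine (WeierstrassCurve.hasSplitMultiplicativeReductionAtPrime_iff_hasSplitMultiplicativeReductionAt W u).mp ?_
              have key : ∀ (q : ℕ) (hq' : Fact q.Prime), q = ℓ → (haveI := hq'; W.HasSplitMultiplicativeReductionAtPrime q) := by
                rintro q hq' rfl; exact hsp
              exact key _ _ hvℓ
            rw [← hvℓ, W.LFunction_apply_primesEquiv_of_hasSplitMultiplicativeReductionAt hsplitv, hvℓ,
              show ((1 : ℤ) : PadicAlgCl p) - (ℓ : PadicAlgCl p) = (((1 - ℓ : ℤ) : ℚ_[p]) : PadicAlgCl p) by push_cast; rfl,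
              PadicAlgCl.norm_extends, Padic.norm_intCast_lt_one_iff]
            exact (Nat.modEq_iff_dvd.mp hℓ1)
          · have hnsv : ¬ W.HasSplitMultiplicativeReductionAt u := by
              intro hsplitv; apply hns
              have h' := (WeierstrassCurve.hasSplitMultiplicativeReductionAtPrime_iff_hasSplitMultiplicativeReductionAt W u).mpr hsplitv
              have key : ∀ (q : ℕ) (hq' : Fact q.Prime), q = ℓ →
                  (haveI := hq'; W.HasSplitMultiplicativeReductionAtPrime q) → W.HasSplitMultiplicativeReductionAtPrime ℓ := by
                rintro q hq' rfl h''; exact h''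
              exact key _ _ hvℓ h'
            rw [← hvℓ, W.LFunction_apply_primesEquiv_of_hasMultiplicativeReductionAt_of_not_split hmultv hnsv, hvℓ,
              show ((-1 : ℤ) : PadicAlgCl p) - (ℓ : PadicAlgCl p) = (((-1 - ℓ : ℤ) : ℚ_[p]) : PadicAlgCl p) by push_cast; rfl,
              PadicAlgCl.norm_extends, Padic.norm_intCast_lt_one_iff]
            have h2 : (p : ℤ) ∣ ((ℓ + 1 : ℕ) : ℤ) - (0 : ℕ) := (Nat.modEq_iff_dvd.mp hℓ1.symm)
            have e : (-1 - ℓ : ℤ) = -(((ℓ + 1 : ℕ) : ℤ) - (0 : ℕ)) := by push_cast; ring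
            rw [e, dvd_neg]; exact h2
        have hmem : ℓ ∈ PF.filter minus := Finset.mem_filter.mpr ⟨hℓPF, hminus⟩
        rw [Finset.prod_eq_zero hmem (sub_self _)]
        ring
    rw [hzero]
    push_cast
    rw [norm_zero]; exact one_pos


/-- **`thm222_anacong_goodLattice_of_ne_one` BY NAME from the two named facts** (no datum: for `θquot|_{Γ_K} ≠ 𝟙` the ℚ-Teichmüller
quotient character is non-trivial, so Kriz's (5) is vacuous). [cite: CastellaGrossiLeeSkinner2022, Thm. 2.2.1 and Thm. 2.2.2]
[cite: Kriz2016, Def. 31, Rem. 32] [cite: Hida2010MuInvariant, Thm. I (p. 45)] [cite: KellerYin2024, Thm. 2.2.2 (statement shape)] -/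
theorem thm222_anacong_goodLattice_of_ne_one_of_proofThm221_of_thmI
    (h221 : proofThm221_congruence_of_fullEisensteinDescent) (hI : thmI_mu_katzLFunction_eq_zero) :
    KellerYin2024.thm222_anacong_goodLattice_of_ne_one := by
  intro W _ _ p _ hp hgood hred hanom hGL K _ _ hK hHN hHp hodd h3 _hEK ι v vbar hv hvbar hne κ hκ γ _ N _ Dt ι' hι'
    ΩK Ωp L hΩK hL θsub θquot hpair hne1 Sf hSf θK hθK Cbar hC ΩK' Ωp' Lφ hΩK' hLφ
  have hpp : p.Prime := Fact.out
  obtain ⟨Φ₀, hΦ₀⟩ := exists_isRationalLine_of_not_irr (W := W) (p := p) hred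
  obtain ⟨θsub₀, θquot₀, hsub₀, hquot₀⟩ := GoodLatticeAnacongOfCGLSProofOfDatum.exists_teichmullerPair_of_line W p hΦ₀
  obtain ⟨rfl, rfl⟩ :=
    ResidualLineRigidity.residualPair_eq_restrictField W p K (by omega) hanom hGL hK hΦ₀ hsub₀ hquot₀ hpair
  -- `θquot₀ ≠ 𝟙` on `Γ_ℚ` since its restriction to `Γ_K` is non-trivial
  have hne1Q : ¬ ∀ σ : absoluteGaloisGroup ℚ, θquot₀ σ = 1 := fun h1 ↦ hne1 fun σ ↦ by
    rw [FramedGaloisRep.restrictField_apply]; exact h1 _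
  -- the type, with (5) vacuous
  obtain ⟨Nplus, Nminus, Nzero, hNp, hNm, hNz, htype, h2, h3', h4, h5⟩ :=
    exists_fullDescentType_of_datum_of_eq_one W hgood hΦ₀ hsub₀ hquot₀ (fun h1 ↦ absurd h1 hne1Q)
  have h1 : ∀ (ℓ : ℕ) (u : HeightOneSpectrum (𝓞 ℚ)), ℓ.Prime → ((ℓ : ℕ) : 𝓞 ℚ) ∈ u.asIdeal →
      ¬ ℓ ∣ W.conductorNorm ℤ → ∀ a : padicCoeffIntegers (∅ : Set (PadicAlgCl p)),
      θquot₀.HasFrobCharpolyAt u (Polynomial.X - Polynomial.C a) →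
      ‖((W.LFunction ℓ : ℤ) : PadicAlgCl p) - ((a : PadicAlgCl p) + (a : PadicAlgCl p)⁻¹ * (ℓ : PadicAlgCl p))‖ < 1 := by
    intro ℓ u hℓ hu hℓN a ha
    by_cases hℓp : ℓ = p
    · subst hℓp
      exact GoodLatticeKrizTraceConditionAtP.kriz_one_at_p_of_anom W hanom hGL hΦ₀ hquot₀ hu ha
    · haveI : Fact ℓ.Prime := ⟨hℓ⟩
      exact GoodLatticeKrizTraceCondition.kriz_one_of_hasGoodReductionAtPrime W hΦ₀ hquot₀ hℓp
        (W.hasGoodReductionAtPrime_of_not_dvd_conductorNorm' hℓN) hu ha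
  exact GoodLatticeAnacongOfCGLSProofThm221.anacong_of_proofThm221_of_thmI h221 hI W p hp hgood hred hanom hGL K hK hHN hHp
    hodd h3 ι v vbar hv hvbar hne κ hκ γ N Dt ι' hι' ΩK Ωp L hΩK hL Φ₀ hΦ₀ θsub₀ θquot₀ hsub₀ hquot₀ Nplus Nminus Nzero hNp hNm hNz
    htype h1 h2 h3' h4 h5 Sf hSf θK hθK Cbar hC ΩK' Ωp' Lφ hΩK' hLφ

end Summit.BirchSwinnertonDyer.BirchSwinnertonDyer.Theorems.GoodLatticeAnacongOfCGLSProofOfNeOne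

end
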